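/-
Copyright (c) 2026 the pub-hodgecm-mathlib formalisation cell (harness21).  Prover seat hodgecm-mathlib-K2Liu-p10 (g7) (L1 hand placed on S8 by chair
K2-lead (g2) ACROSS-LINES VALVE 15 (i)), Track B ∕ K2-LIT, h413 = `stmt-HodgeConjecture-24833`, R90-TF section S8 «ContSpec-n½», the (M) «middle
residue» road, item (M-c) ORIENT — the CONSUMER-SHAPED PROJECTIONS of the named fact ★∕📤 `Literature.NumberTheory.Rogawski1990.KeysOrientation`
(S8 dealer R90-CS-plan (g3), S8-R218 (1)).  THEOREMS ONLY (no `def`, no instance, no notation, no `sorry`).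
-/
import Literature.NumberTheory.Rogawski1990.U3PrincipalSeriesKeysOrientation   -- ★∕📤 the named fact `KeysOrientation` (this seat) over ★ `KeysCaseTwoLabels`, `Gqs`, `cmPrincipalSeries`, `cmXiTorusChar`
import HarnessLib

/-!
# S8 (M) road, (M-c) ORIENT — consumer projections of `Rogawski1990.KeysOrientation` at the data of Keys' case (2): an irreducible QUOTIENT of
# `i_G(χ_ξ)` IS `πⁿ(ξ_v)` (a constituent, NOT square-integrable); an irreducible SUB is `π²(ξ_v)`; the maximal proper `G`-stable subspace

Track B ∕ K2-LIT, crux h413 = `stmt-HodgeConjecture-24833`, route of record `HCCMUnconditional`; cell `hodgecm-mathlib`, R90-TF programme, section S8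
«ContSpec-n½», the (M) «middle residue» road of socket B ED. 7 :299 (dealer R90-CS-plan (g3), S8-R218 (1); road census K2E1-p10 (g5) `CENSUS-M-sock299` (M-c)).
Lane `--supports stmt-HodgeConjecture-24833 --as helper` (count-neutral).  CLOSES NO SOCKET.  The named fact itself — «at a non-split place, `π²(ξ_v)` is
the unique irreducible SUB and `πⁿ(ξ_v)` the unique irreducible QUOTIENT of `cmPrincipalSeries L 3 v (cmXiTorusChar L v μ η₁ η₂)` (exponent `+½`)», with the
length-two clause — is the Literature def ★∕📤 `Literature.NumberTheory.Rogawski1990.KeysOrientation` (UNPROVED; a consumer taking `(h : KeysOrientation L)` is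
CONDITIONAL on it).  THIS FILE: the projections at the data `(v, μ, η₁, η₂, μZ, πs, πn)` that the (M) FILE 1 `R90S8ResMiddleResidueIsPiNOfLettersU3` (K2E1-p10 (g6))
binds — **`mk_eq_piN_of_quotient_of_keysOrientation`** (an irreducible quotient has class `πn`), **`isPiN_quotient_of_keysOrientation`** (… hence is a
constituent of `i_G(χ_ξ)` (★ `KeysCaseTwoLabels`) and is NOT square-integrable for `μZ`: the (ISO)-letter currency), `mk_eq_piTwo_of_sub_of_keysOrientation`,
`exists_maximalSub_of_keysOrientation` (the `G`-stable `K` with `∀ N, N = ⊥ ∨ N = K ∨ N = ⊤`, carrying `π²`, quotient `πⁿ` — where «`ker N_v(3∕2) = π²`,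
`im ≅ πⁿ`» is read).  Elaboration note: the CM carrier `Gqs L v` against the matrix carrier of ★ `cmPrincipalSeries` and `Representation.quotient`'s `≤`-binder
cost ≈ 10⁶ heartbeats per statement (as ★ `F0P2pCmPrincipalSeriesInterface`; measured), hence the section-local options.
HONEST LABEL: HC_CM is proved only modulo the 7 printed citations (2 remaining named inputs: hLiu418 = `stmt-HodgeConjecture-24832`, h413 =
`stmt-HodgeConjecture-24833`) until rung 0 closes; REL ≠ ★ ≠ BUILT; every theorem here is CONDITIONAL on `KeysOrientation`; count-neutral.

## References
* [Keys1984] C. D. Keys, Compositio Math. 51 (1984) 115–130, §7.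
* [Rogawski1990] J. D. Rogawski, Ann. of Math. Stud. 123 (1990), §11.4 p. 164, §12.2 (2) pp. 173–174.
* [BorelWallach2000] A. Borel, N. Wallach, 2nd ed. (2000), XI §2.
* [BernsteinZelevinsky1977] I. N. Bernstein, A. V. Zelevinsky, Ann. Sci. ÉNS 10 (1977), §2.
-/

set_option autoImplicit false
set_option linter.dupNamespace false  -- the mandated namespace `…HodgeConjecture.HodgeConjecture.R90.S8` repeats the summit's segment

noncomputable section

open NumberField IsDedekindDomain MeasureTheory
open Literature.NumberTheory Literature.NumberTheory.Automorphic Literature.NumberTheory.Rogawski1990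

namespace Summit.HodgeConjecture.HodgeConjecture.R90.S8

variable {L : Type} [Field L] [NumberField L] [IsCMField L]

/-! ## §2 Consumer-shaped projections at the data of case (2) (the (ISO)-letter currency of the (M) road) -/

section Consumer

set_option synthInstance.maxHeartbeats 400000
set_option maxHeartbeats 4000000 -- section-local («measured», as ★ `F0P2pCmPrincipalSeriesInterface`): the CM carrier `Gqs L v` vs the matrix carrier of ★ `cmPrincipalSeries` + `Representation.quotient`'s `≤`-binder cost ≈ 10⁶ heartbeats per statement (default 2·10⁵ times out at `whnf`)

variable (h : KeysOrientation L) {v : HeightOneSpectrum (𝓞 ↥(maximalRealSubfield L))}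
  (hns : ∀ w : UnitaryGroup.PlacesOver L v, IsCMField.complexConj L • w.1 = w.1)
  {μ : (UnitaryGroup.LocalRing L v)ˣ →* ℂˣ}
  {η₁ η₂ : ↥(UnitaryGroup.normOneUnits (UnitaryGroup.conjLocal L (IsCMField.complexConj L) v)) →* ℂˣ}
  (hμ : UnitaryGroup.IsQuadraticCharExtension (UnitaryGroup.conjLocal L (IsCMField.complexConj L) v) μ)
  (hμc : Continuous (fun x => ((μ x : ℂˣ) : ℂ))) (h1c : Continuous (fun x => ((η₁ x : ℂˣ) : ℂ)))
  (h2c : Continuous (fun x => ((η₂ x : ℂˣ) : ℂ)))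
  [MeasurableSpace (Gqs L v ⧸ Subgroup.center (Gqs L v))] [BorelSpace (Gqs L v ⧸ Subgroup.center (Gqs L v))]
  (μZ : Measure (Gqs L v ⧸ Subgroup.center (Gqs L v))) [μZ.IsHaarMeasure]
  {πs πn : IrrClass (Gqs L v)} (hK : KeysCaseTwoLabels L v μ η₁ η₂ πs πn)
  (hs : πs.IsSquareIntegrable μZ) (hn : ¬ πn.IsSquareIntegrable μZ)

include h hns hμ hμc h1c h2c hK hs hn

/-- **An irreducible QUOTIENT of `i_G(χ_ξ)` has class `πⁿ(ξ_v)`** (clause (ii) of `KeysOrientation` at the data).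
[cite: Rogawski1990, §11.4 p. 164; §12.2 (2) pp. 173–174] [cite: Keys1984, §7] -/
theorem mk_eq_piN_of_quotient_of_keysOrientation (r : SmoothIrrep (Gqs L v))
    (N : Subrepresentation (UnitaryGroup.cmPrincipalSeries L 3 v (UnitaryGroup.cmXiTorusChar L v μ η₁ η₂)))
    (e : r.ρ.Equiv ((UnitaryGroup.cmPrincipalSeries L 3 v (UnitaryGroup.cmXiTorusChar L v μ η₁ η₂)).quotient N.toSubmodule
      fun g _ hx => N.apply_mem_toSubmodule g hx)) :
    IrrClass.mk r = πn :=
  (h v hns μ η₁ η₂ hμ hμc h1c h2c μZ πs πn hK hs hn).2.1 r N ⟨e⟩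

/-- **An irreducible SUBrepresentation of `i_G(χ_ξ)` has class `π²(ξ_v)`** (clause (i) of `KeysOrientation` at the data).
[cite: Rogawski1990, §12.2 (2) pp. 173–174] [cite: Keys1984, §7] -/
theorem mk_eq_piTwo_of_sub_of_keysOrientation (r : SmoothIrrep (Gqs L v))
    (N : Subrepresentation (UnitaryGroup.cmPrincipalSeries L 3 v (UnitaryGroup.cmXiTorusChar L v μ η₁ η₂)))
    (e : r.ρ.Equiv N.toRepresentation) : IrrClass.mk r = πs :=
  (h v hns μ η₁ η₂ hμ hμc h1c h2c μZ πs πn hK hs hn).1 r N ⟨e⟩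

/-- **THE CONSUMER SHAPE OF (M-c) FOR THE (M) ROAD: an irreducible QUOTIENT of `i_G(χ_ξ)` IS `πⁿ(ξ_v)`** — its class is `πn`, it is a constituent of
`i_G(χ_ξ)` (★ `KeysCaseTwoLabels`), and it is NOT square-integrable for `μZ` (the (ISO)-letter's «`x.IsConstituentOf … ∧ ¬ x.IsSquareIntegrable μZ`» at `x :=` the
class of the quotient). [cite: Rogawski1990, §11.4 p. 164; §12.2 (2) pp. 173–174] [cite: Keys1984, §7] [cite: BorelWallach2000, XI §2] -/
theorem isPiN_quotient_of_keysOrientation (r : SmoothIrrep (Gqs L v))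
    (N : Subrepresentation (UnitaryGroup.cmPrincipalSeries L 3 v (UnitaryGroup.cmXiTorusChar L v μ η₁ η₂)))
    (e : r.ρ.Equiv ((UnitaryGroup.cmPrincipalSeries L 3 v (UnitaryGroup.cmXiTorusChar L v μ η₁ η₂)).quotient N.toSubmodule
      fun g _ hx => N.apply_mem_toSubmodule g hx)) :
    IrrClass.mk r = πn ∧
      (IrrClass.mk r).IsConstituentOf (UnitaryGroup.cmPrincipalSeries L 3 v (UnitaryGroup.cmXiTorusChar L v μ η₁ η₂)) ∧
      ¬ (IrrClass.mk r).IsSquareIntegrable μZ := by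
  have hr : IrrClass.mk r = πn := mk_eq_piN_of_quotient_of_keysOrientation h hns hμ hμc h1c h2c μZ hK hs hn r N e
  refine ⟨hr, ?_, ?_⟩
  · rw [hr]
    exact (hK.2 πn).2 (Or.inl rfl)
  · rw [hr]
    exact hn

/-- **THE MAXIMAL PROPER `G`-STABLE SUBSPACE** (clause (iii) of `KeysOrientation` at the data): a `G`-stable `K ≤ i_G(χ_ξ)`, the only proper non-zero one,
carrying `π²(ξ_v)` with quotient carrying `πⁿ(ξ_v)` — the shape in which «`ker N_v(3∕2) = π²`, `im ≅ πⁿ`» is read (a non-zero, non-injective `G`-map out of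
`i_G(χ_ξ)` has kernel `K`). [cite: Rogawski1990, §11.4 p. 164; §12.2 (2) pp. 173–174] [cite: Keys1984, §7] [cite: BernsteinZelevinsky1977, §2] -/
theorem exists_maximalSub_of_keysOrientation :
    ∃ K : Subrepresentation (UnitaryGroup.cmPrincipalSeries L 3 v (UnitaryGroup.cmXiTorusChar L v μ η₁ η₂)),
      (∀ N : Subrepresentation (UnitaryGroup.cmPrincipalSeries L 3 v (UnitaryGroup.cmXiTorusChar L v μ η₁ η₂)), N = ⊥ ∨ N = K ∨ N = ⊤) ∧
      (∃ r : SmoothIrrep (Gqs L v), IrrClass.mk r = πs ∧ Nonempty (r.ρ.Equiv K.toRepresentation)) ∧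
      (∃ r : SmoothIrrep (Gqs L v), IrrClass.mk r = πn ∧ Nonempty (r.ρ.Equiv
        ((UnitaryGroup.cmPrincipalSeries L 3 v (UnitaryGroup.cmXiTorusChar L v μ η₁ η₂)).quotient K.toSubmodule
          fun g _ hx => K.apply_mem_toSubmodule g hx))) :=
  (h v hns μ η₁ η₂ hμ hμc h1c h2c μZ πs πn hK hs hn).2.2

end Consumer

end Summit.HodgeConjecture.HodgeConjecture.R90.S8

end
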